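import Summits.BirchSwinnertonDyer.BirchSwinnertonDyer.Theorems.EisensteinPrimesKatzLineIntFrame
import Summits.BirchSwinnertonDyer.BirchSwinnertonDyer.Theorems.EisensteinPrimesKatzLineDescent
import Literature.NumberTheory.EllipticCurves.IwasawaAlgebraStructureProofs
import HarnessLib

/-!
# `μ = 0` passes BACK from an `R₀`-valued Katz `L`-function to the `ℤ_p`-form of Rubin's two-variable
# frame: `g(S=0) mod p ≠ 0` WITHOUT Hida's Theorem I by name
# (helper file for crux 2 `GoodLatticeBDPValue`, stmt-BirchSwinnertonDyer-19032, line `halves` v23; width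
# seat `bsd-line-x1-p1-w5` gen 5; `--supports stmt-BirchSwinnertonDyer-19032`)

WHY. On line `halves` v23 the published named fact `Hida2010MuInvariant.thmI_mu_katzBranch_reflect_eq_zero`
(Hida 2010 Thm. I typed on the REFLECTED de Shalit frame; conjunct 5 of `stub_publishedFacts`) is consumed
in exactly one way: `IwasawaTwoVariable.map_residue_constantCoeff_ne_zero_of_katzMeasure₂ hF hO1 …` turns
it into `g(S=0) mod p ≠ 0` for the `ℤ_p`-form `g` of Rubin's two-variable Katz–de Shalit frame `G` of
`θ_K⁻¹` (the input `hg0` of `muLambda_of_rubin`, of the joint `[BR𝟙]/[BRω]` theorem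
`EisensteinPrimesMuLambda.goodLattice_jointMuLambda_of_facts` §5, and of the AN-F₁ frame
`KatzLineFrame.exists_katzLineIntFrame`). This file proves that SAME conclusion from de Shalit II.6.4 (`hF`)
and ANY `R₀`-valued CGLS-type witness `L` of `θ_K` on the anticyclotomic line (`IsKatzLFunction ι v v̄ ∅ κ γ
θ_K Ω_K'' Ω_p'' L`) that has a coefficient of norm `1` — i.e. from "`μ(𝓛_θ) = 0`" in the CGLS
`R₀`-currency, which the line ALREADY carries: it is a clause of the conclusion of
`KellerYin2024.thm222_anacong_goodLattice_OPEN` (⇐ 3a-A + `…_of_five_le`), and it is the conclusion of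
the first typing `Hida2010MuInvariant.thmI_mu_katzLFunction_eq_zero` of the same printed theorem. So the
second currency of Hida's theorem is not an independent input of the line (the comparison "would need
Strassmann … none in the tree", `AnticyclotomicKatzBranchMuInvariant.lean` module docstring, is now IN the
tree: w4 gen 2's power-map rigidity and utd-p1's `μ`-transfer, used here in reverse).

THE ARGUMENT (the `μ`-transfer of `UniversalToricDescentFlatMuTransfer` run backwards, which works because
the ♭-frame is a UNIT MULTIPLE OF A `ℤ_p`-SERIES). By II.6.4 on the anticyclotomic line
(`anticyclotomicLine_left`) and the frame transport of `KatzLineFrame` §1–§2, `Q := C(ι⁻¹(4ζ⁻¹))·Ǧ(·,0)` is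
a ♭-frame of `θ_K` (`Cbar = ∅`, periods `Ω`, `Ω_p w⁻¹`), and `Q ~ J(g(·,0))` in `𝓞_{ℂ_p}⟦T⟧`
(`associated_of_relation`, `J(g) ~ G`). Two frames of one finite-order `θ_K` satisfy the power-map
identity `Q(Φ)·L♭^p = Q^p·L♭(Φ)`, `Φ = (1+T)^p − 1` (`KatzLineRigidity.katzFlat_powerMap_identity`) and
vanish together (`katzFlat_eq_zero_of_eq_zero`), so `g(·,0) ≠ 0`. Write `g(·,0) = p^m·g₁`, `g₁ ≢ 0 (mod p)`
(`IwasawaAlgebra.exists_eq_C_pow_mul_and_map_residue_ne_zero`); then `Q = p^m·M` with `M = J(g₁)·U` of unit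
content, and if `m ≥ 1`, cancelling `p^m` in the domain `𝓞_{ℂ_p}⟦T⟧` gives
`M(Φ)·L♭^p = p^{(p−1)m}·M^p·L♭(Φ)`, contradicting `false_of_powMap_identity_of_pow` (reduction modulo
`𝔪_{ℂ_p}`: `M̄(T^p)·L̄♭^p ≠ 0`). Hence `m = 0`.

* §1 `map_residue_ne_zero_of_powMap_identity_of_associated` — the algebra (any `p`).
* §2 **`map_residue_constantCoeff_ne_zero_of_isKatzLFunction`** — `g(S=0) mod p ≠ 0` from (F) and an
  `R₀`-frame with a unit coefficient (θ_K-explicit binders = those of `KatzLineFrame.exists_katzLineIntFrame`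
  minus `hg0`).

THEOREMS ONLY (no definition, no named fact introduced, no `sorry`; imports no `Theses` module). HONEST
FRAMING: de Shalit II.6.4 enters as the hypothesis `hF`; nothing about BSD / IMC2 / KY Thm. 3.0.8 / the crux
is proved here; the file only shows that the line's `μ`-input can be fed in the CGLS `R₀`-currency.
References: [deShalit1987] II.4.16, II.6.1, II.6.4 (i); [CastellaGrossiLeeSkinner2022] Thm. 2.1.2, Thm. 2.2.2;
[Hida2010MuInvariant] Thm. I; [Washington1997] §7.1–7.2; [GreenbergVatsal2000] p. 2 (1)–(2).
-/

-- the summit namespace `Summit.BirchSwinnertonDyer.BirchSwinnertonDyer` repeats the problem name by design (D-0017)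
set_option linter.dupNamespace false
set_option autoImplicit false

noncomputable section

open scoped Classical Topology

open Filter PowerSeries NumberField IsDedekindDomain Field Literature.NumberTheory.EllipticCurves
  Literature.NumberTheory.EllipticCurves.CastellaGrossiLeeSkinner2022
  Literature.NumberTheory.EllipticCurves.GreenbergVatsal2000
  Literature.NumberTheory.EllipticCurves.KellerYin2024
  Literature.NumberTheory.GaloisRepresentations Literature.NumberTheory.GaloisRepresentations.HeckeCharacter
  Literature.NumberTheory.EllipticCurves.Rubin1991 Literature.NumberTheory.EllipticCurves.DeShalit1987
  Literature.NumberTheory.EllipticCurves.Hida2010MuInvariant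
  Summit.BirchSwinnertonDyer.Rank1Residual Summit.BirchSwinnertonDyer.Rank1Residual.X11b
  Summit.BirchSwinnertonDyer.Rank1Residual.X11b.LambdaSupply
  Summit.BirchSwinnertonDyer.Rank1Residual.X11b.Three.LambdaSupply
  Summit.BirchSwinnertonDyer.BirchSwinnertonDyer.Theorems.IwasawaTwoVariable
  Summit.BirchSwinnertonDyer.BirchSwinnertonDyer.Theorems.UniversalToricDescentFlatMuTransfer
  Summit.BirchSwinnertonDyer.BirchSwinnertonDyer.Theorems.KatzLineRigidity
  Summit.BirchSwinnertonDyer.BirchSwinnertonDyer.Theorems.KatzLineFrame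

namespace Summit.BirchSwinnertonDyer.BirchSwinnertonDyer.Theorems.KatzLineReverseMuTransfer

variable {p : ℕ} [hp : Fact p.Prime]

/-! ### §1 Algebra: the functional equation with `μ(M₀) = 0` forces `μ = 0` on a `ℤ_p`-form of the other side -/

/-- **`μ`-TRANSFER THROUGH THE POWER-MAP FUNCTIONAL EQUATION, TO A `ℤ_p`-FORM.** Let `M₀ ∈ 𝓞_{ℂ_p}⟦T⟧`
have a coefficient of norm `1`; let `a ∈ ℤ_p⟦T⟧` be non-zero and `Q ~ J(a)` in `𝓞_{ℂ_p}⟦T⟧` for a structure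
map `J : ℤ_p → 𝓞_{ℂ_p}`; and suppose `Q((1+T)^p − 1)·M₀^p = Q^p·M₀((1+T)^p − 1)`. Then `a mod p ≠ 0`. Proof:
`a = p^m·a₁` with `a₁ ≢ 0 (mod p)` (`IwasawaAlgebra.exists_eq_C_pow_mul_and_map_residue_ne_zero`), so
`Q = p^m·M` with `M = J(a₁)·U` of unit content; if `m ≥ 1`, cancel `p^m` and apply
`UniversalToricDescentFlatMuTransfer.false_of_powMap_identity_of_pow` with `j = (p−1)m`.
[cite: Washington1997, §7.1 (Lemma 7.5 ff.), §7.2 (the p-power map)] [cite: GreenbergVatsal2000, p. 2, (1)–(2)] -/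
theorem map_residue_ne_zero_of_powMap_identity_of_associated {M₀ Q : PowerSeries 𝓞_ℂ_[p]}
    (hM₀ : ∃ i : ℕ, ‖((PowerSeries.coeff i M₀ : 𝓞_ℂ_[p]) : ℂ_[p])‖ = 1)
    {J : ℤ_[p] →+* 𝓞_ℂ_[p]} (hJ : ∀ x : ℤ_[p], ((J x : 𝓞_ℂ_[p]) : ℂ_[p]) = ((x : ℚ_[p]) : ℂ_[p]))
    {a : IwasawaAlgebra p} (ha : a ≠ 0) (hassoc : Associated (PowerSeries.map J a) Q)
    (h : Q.subst (((1 + X : PowerSeries 𝓞_ℂ_[p]) ^ p) - 1) * M₀ ^ p =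
      Q ^ p * M₀.subst (((1 + X : PowerSeries 𝓞_ℂ_[p]) ^ p) - 1)) :
    a.map (IsLocalRing.residue ℤ_[p]) ≠ 0 := by
  obtain ⟨m, a₁, hma, ha₁⟩ := IwasawaAlgebra.exists_eq_C_pow_mul_and_map_residue_ne_zero p ha
  obtain ⟨u, hu⟩ := hassoc
  -- `M := J(a₁)·u` has unit content
  set M : PowerSeries 𝓞_ℂ_[p] := PowerSeries.map J a₁ * ↑u with hMdef
  have hM : ∃ i : ℕ, ‖((PowerSeries.coeff i M : 𝓞_ℂ_[p]) : ℂ_[p])‖ = 1 := by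
    rw [← hasUnitContent_iff_exists_norm_coeff_eq_one]
    have h1 : HasUnitContent (PowerSeries.map J a₁) :=
      (hasUnitContent_map_iff_of_coe_eq hJ a₁).2 ((hasUnitContent_iff_map_residue_ne_zero a₁).2 ha₁)
    rw [hMdef, mul_comm]
    exact (hasUnitContent_mul_iff_of_isUnit u.isUnit _).2 h1
  rcases Nat.eq_zero_or_pos m with hm | hm
  · -- `m = 0`: `a = a₁`
    rw [hm, pow_zero, map_one, one_mul] at hma
    rw [hma]
    exact ha₁
  · exfalso
    -- `Q = p^m · M`
    have hQ : Q = PowerSeries.C ((p : 𝓞_ℂ_[p]) ^ m) * M := by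
      rw [← hu, hma, map_mul, PowerSeries.map_C, map_pow, map_natCast, hMdef, mul_assoc]
    -- substitute into the functional equation
    have hsubstC : (PowerSeries.C ((p : 𝓞_ℂ_[p]) ^ m) * M).subst (((1 + X : PowerSeries 𝓞_ℂ_[p]) ^ p) - 1) =
        PowerSeries.C ((p : 𝓞_ℂ_[p]) ^ m) * M.subst (((1 + X : PowerSeries 𝓞_ℂ_[p]) ^ p) - 1) := by
      rw [← smul_eq_C_mul, ← smul_eq_C_mul, PowerSeries.subst_smul (hasSubst_powMap p)]
    rw [hQ] at h
    -- `h : (C(p^m)·M)(Φ) * M₀^p = (C(p^m)·M)^p * M₀(Φ)`; normalise both sides and cancel `C(p^m)`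
    have hp0 : (PowerSeries.C ((p : 𝓞_ℂ_[p]) ^ m) : PowerSeries 𝓞_ℂ_[p]) ≠ 0 := by
      intro h0
      have := congrArg PowerSeries.constantCoeff h0
      rw [PowerSeries.constantCoeff_C, map_zero] at this
      exact pow_ne_zero m (by exact_mod_cast hp.out.ne_zero : (p : 𝓞_ℂ_[p]) ≠ 0) this
    have hsplit : (p : 𝓞_ℂ_[p]) ^ (m * p) = (p : 𝓞_ℂ_[p]) ^ m * (p : 𝓞_ℂ_[p]) ^ ((p - 1) * m) := by
      rw [← pow_add]
      congr 1
      have h1 : 1 ≤ p := hp.out.one_le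
      zify [h1]
      ring
    have hpow : (PowerSeries.C ((p : 𝓞_ℂ_[p]) ^ m) * M) ^ p =
        PowerSeries.C ((p : 𝓞_ℂ_[p]) ^ m) * (PowerSeries.C ((p : 𝓞_ℂ_[p]) ^ ((p - 1) * m)) * M ^ p) := by
      rw [mul_pow, ← map_pow, ← pow_mul, hsplit, map_mul, mul_assoc]
    have key : PowerSeries.C ((p : 𝓞_ℂ_[p]) ^ m) *
          (M.subst (((1 + X : PowerSeries 𝓞_ℂ_[p]) ^ p) - 1) * M₀ ^ p) =
        PowerSeries.C ((p : 𝓞_ℂ_[p]) ^ m) * (PowerSeries.C ((p : 𝓞_ℂ_[p]) ^ ((p - 1) * m)) *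
          (M ^ p * M₀.subst (((1 + X : PowerSeries 𝓞_ℂ_[p]) ^ p) - 1))) := by
      calc PowerSeries.C ((p : 𝓞_ℂ_[p]) ^ m) * (M.subst (((1 + X : PowerSeries 𝓞_ℂ_[p]) ^ p) - 1) * M₀ ^ p)
          = (PowerSeries.C ((p : 𝓞_ℂ_[p]) ^ m) * M).subst (((1 + X : PowerSeries 𝓞_ℂ_[p]) ^ p) - 1) *
              M₀ ^ p := by rw [hsubstC, mul_assoc]
        _ = (PowerSeries.C ((p : 𝓞_ℂ_[p]) ^ m) * M) ^ p *
              M₀.subst (((1 + X : PowerSeries 𝓞_ℂ_[p]) ^ p) - 1) := h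
        _ = PowerSeries.C ((p : 𝓞_ℂ_[p]) ^ m) * (PowerSeries.C ((p : 𝓞_ℂ_[p]) ^ ((p - 1) * m)) *
              (M ^ p * M₀.subst (((1 + X : PowerSeries 𝓞_ℂ_[p]) ^ p) - 1))) := by
            rw [hpow, mul_assoc, mul_assoc]
    have h' := mul_left_cancel₀ hp0 key
    exact false_of_powMap_identity_of_pow hM₀ hM (Nat.mul_pos (Nat.sub_pos_of_lt hp.out.one_lt) hm) h'

/-! ### §2 `g(S=0) mod p ≠ 0` for Rubin's frame, from (F) and an `R₀`-frame with a unit coefficient -/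

/-- **(R5′) `μ`-half WITHOUT Hida's Theorem I by name.** `K` imaginary quadratic (CM), `2 < p = v v̄` split
with `v` read through `ι`, `κ` anticyclotomic with topological generator `γ`, `(κ, κ'; γ, γ')` a generator
pair, `θ_K` a Hecke character of FINITE ORDER, `c`-INVARIANT, UNRAMIFIED AT `v` AND `v̄`, `S` its exact
ramification set, de Shalit period data `Ω ≠ 0`, `δ² = ±D_K`, `Ω_p ∈ R₀ˣ`, a two-variable frame
`IsKatzMeasure₂ ι v v̄ S κ κ' γ⁻¹ γ'⁻¹ θ_K⁻¹ Ω δ Ω_p G`, a structure map `J : ℤ_p → 𝓞_{ℂ_p}`, `g ∈ ℤ_p⟦S⟧⟦T⟧`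
with `J(g) ~ G` — the binders of `KatzLineFrame.exists_katzLineIntFrame` WITHOUT its `hg0` —, GRANTED de
Shalit II.6.4 (`hF`), and IN ADDITION one `R₀`-valued CGLS-type witness `L` of `θ_K` on the anticyclotomic
line (`IsKatzLFunction ι v v̄ ∅ κ γ θ_K Ω_K'' Ω_p'' L`, `Ω_K'', Ω_p'' ≠ 0`) with a coefficient of norm `1`:
THEN `g(S=0) mod p ≠ 0`. (The anticyclotomic line of `G`, reflected by II.6.4 and rescaled, is a ♭-frame
`Q ~ J(g(S=0))` of `θ_K`; `Q` and `L♭` satisfy the power-map identity and vanish together; §1.)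
[cite: deShalit1987, II.6.4 Theorem (i) (9), (14)–(15); II.4.16 (49)–(50); II.6.1 (1)]
[cite: CastellaGrossiLeeSkinner2022, Thm. 2.1.2 (arXiv:2008.02571v2 TeX L1015–1041)]
[cite: Hida2010MuInvariant, Thm. I (p. 45) (the statement replaced at its use site)]
[cite: Washington1997, §7.1 Prop. 7.2, §7.2] -/
theorem map_residue_constantCoeff_ne_zero_of_isKatzLFunction
    (hF : thmII64_katzMeasure₂_functionalEquation)
    {K : Type} [Field K] [NumberField K] [IsCMField K] (hK : IsImaginaryQuadratic K) (hp2 : 2 < p)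
    {ι : PadicAlgCl p ≃+* ℂ} {v vbar : HeightOneSpectrum (𝓞 K)} (hv : ((p : ℕ) : 𝓞 K) ∈ v.asIdeal)
    (hvbar : ((p : ℕ) : 𝓞 K) ∈ vbar.asIdeal) (hne : vbar ≠ v)
    (hι : ∀ (w : InfinitePlace K) (k : 𝓞 K), k ∈ v.asIdeal ↔ ‖ι.symm (w.embedding (k : K))‖ < 1)
    {κ κ' : ZpExtension K p} (hκ : κ.IsAnticyclotomic) {γ γ' : absoluteGaloisGroup K}
    (hγ : κ.IsTopGenerator γ) (hpair : ZpExtension.IsTopGeneratorPair κ κ' γ γ')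
    {θK : HeckeCharacter K} (hfin : θK.IsFiniteOrder)
    (hgal : HeckeCharacter.galConj (IsCMField.complexConj K) θK = θK)
    (hθv : θK.IsUnramifiedAt v) (hθvbar : θK.IsUnramifiedAt vbar)
    {S : Finset (HeightOneSpectrum (𝓞 K))}
    (hS : ∀ w : HeightOneSpectrum (𝓞 K), w ∈ S ↔ ¬ θK.IsUnramifiedAt w)
    {Ω δ : ℂ} {Ωp : (unrIntegers p)ˣ} {G : PowerSeries (PowerSeries 𝓞_ℂ_[p])} (hΩ : Ω ≠ 0)
    (hδ : δ ^ 2 = (NumberField.discr K : ℂ) ∨ δ ^ 2 = -(NumberField.discr K : ℂ))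
    (hG : IsKatzMeasure₂ ι v vbar S κ κ' γ⁻¹ γ'⁻¹ θK⁻¹ Ω δ ((Ωp : unrIntegers p) : ℂ_[p]) G)
    {g : IwasawaAlgebra₂ p} {J : ℤ_[p] →+* 𝓞_ℂ_[p]}
    (hJ : ∀ x : ℤ_[p], ((J x : 𝓞_ℂ_[p]) : ℂ_[p]) = ((x : ℚ_[p]) : ℂ_[p]))
    (hassoc : Associated (PowerSeries.map (PowerSeries.map J) g) G)
    {ΩK'' : ℂ} {Ωp'' : ℂ_[p]} {L : UnrSeries p} (hΩK'' : ΩK'' ≠ 0) (hΩp'' : Ωp'' ≠ 0)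
    (hL : IsKatzLFunction ι v vbar ∅ κ γ θK ΩK'' Ωp'' L)
    (hμ : ∃ i : ℕ, ‖((PowerSeries.coeff i L : unrIntegers p) : ℂ_[p])‖ = 1) :
    (g.map (PowerSeries.constantCoeff (R := ℤ_[p]))).map (IsLocalRing.residue ℤ_[p]) ≠ 0 := by
  have hprime : p.Prime := Fact.out
  have hp2' : p ≠ 2 := by omega
  -- `θ_K⁻¹`: algebraic, unramified at `v`, `v̄`, ramified exactly on `S`
  have hvS : v ∉ S := fun h ↦ (hS v).1 h hθv
  have hvbarS : vbar ∉ S := fun h ↦ (hS vbar).1 h hθvbar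
  have hlam : (θK⁻¹).IsAlgebraic :=
    HeckeCharacter.IsFiniteOrder.isAlgebraic (show IsOfFinOrder θK⁻¹ from IsOfFinOrder.inv hfin)
  have hprim : ∀ w ∈ S, ¬ (θK⁻¹).IsUnramifiedAt w := fun w hw h ↦ (hS w).1 hw (by
    have h' := h.inv'
    rwa [inv_inv] at h')
  have hunr : ∀ w : HeightOneSpectrum (𝓞 K), w ∉ S → w ≠ v → w ≠ vbar → (θK⁻¹).IsUnramifiedAt w :=
    fun w hw _ _ ↦ (not_not.1 ((hS w).not.1 hw)).inv'
  -- (F) on the anticyclotomic line at the inverse generators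
  obtain ⟨Gc, C₁, g₀, -, hGcB, hC₁, hrel⟩ := hF.anticyclotomicLine_left hK hv hvbar hne hι hΩ hδ hvS
    hvbarS hlam hθv.inv' hθvbar.inv' hprim hunr hpair.isUnitGeneratorPair_inv hκ hG
  rw [image_complexConj_eq_of_galConj_eq hgal hS] at hGcB
  -- the constants of the frame transport
  have hD : (NumberField.discr K : ℂ) ≠ 0 := by exact_mod_cast NumberField.discr_ne_zero K
  have hδ0 : δ ≠ 0 := by
    rintro rfl
    rcases hδ with h | h
    · exact hD (by simpa using h.symm)
    · exact hD (by simpa using h.symm)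
  obtain ⟨w, c₀, hw, hwn, hc₀, hc₀n⟩ := exists_frame_constants hp2' ι (zeta_pow_four_eq_one hD hδ)
  have hw0 : w ≠ 0 := fun h ↦ by
    rw [h, norm_zero] at hwn
    exact zero_ne_one hwn
  -- the ♭-frame `Q := C(c₀)·Ǧ(·,0)` of `θ_K` at the periods `(Ω, Ω_p w⁻¹)`
  set Q : PowerSeries 𝓞_ℂ_[p] :=
    PowerSeries.C c₀ * PowerSeries.map (PowerSeries.constantCoeff (R := 𝓞_ℂ_[p])) Gc with hQdef
  have hQ : ∀ (φ : HeckeCharacter K) (n : ℕ), 0 < n → (p - 1) ∣ n →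
      (∀ w : HeightOneSpectrum (𝓞 K), φ.IsUnramifiedAt w) →
      φ.HasInfinityType (fun _ ↦ (n : ℤ)) (fun _ ↦ -(n : ℤ)) →
      ∀ (hLc : LFunction.HasEntireContinuation (heckeLFunction (θK * φ))),
      ∀ r : FramedGaloisRep K (PadicAlgCl p) 1, IsPAdicAvatarOf ι φ r → FactorsThroughZp κ r →
        IntSeries.HasValueAt Q (avatarValueAt r γ - 1)
          (((ι.symm (katzInterpolationValue p θK v vbar ∅ φ n Ω (hLc.continuation 1)) :
              PadicAlgCl p) : ℂ_[p]) * (((Ωp : unrIntegers p) : ℂ_[p]) * w⁻¹) ^ (2 * n)) :=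
    fun φ n hn _ hφunr hφinf hLc r hr hκr ↦
      hasValueAt_C_mul_of_isKatzBranch_reflect_inv hK hv hvbar hne hfin hgal hθv hθvbar hS hκ hδ0
        hGcB hw hw0 hc₀ φ n hn hφunr hφinf hLc r hr hκr
  have hΩp0 : ((Ωp : unrIntegers p) : ℂ_[p]) ≠ 0 := by
    rw [← norm_pos_iff, Halves.norm_coe_units_unrIntegers]
    exact one_pos
  have hΩp' : ((Ωp : unrIntegers p) : ℂ_[p]) * w⁻¹ ≠ 0 := mul_ne_zero hΩp0 (inv_ne_zero hw0)
  -- the `R₀`-frame read in `𝓞_{ℂ_p}⟦T⟧`, with its unit coefficient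
  have hLflat := katzFlat_map_of_isKatzLFunction hL
  have hLunit : ∃ i : ℕ,
      ‖((PowerSeries.coeff i (PowerSeries.map (R1.unrToCpInt p) L) : 𝓞_ℂ_[p]) : ℂ_[p])‖ = 1 := by
    obtain ⟨i, hi⟩ := hμ
    exact ⟨i, by rw [PowerSeries.coeff_map, R1.coe_unrToCpInt]; exact hi⟩
  -- `Q ~ J(g(S=0))`: (F)'s unit relation, `J(g) ~ G`, and `‖c₀‖ = 1`
  have hassocGc : Associated (PowerSeries.map (PowerSeries.constantCoeff (R := 𝓞_ℂ_[p])) Gc)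
      (PowerSeries.map (PowerSeries.constantCoeff (R := 𝓞_ℂ_[p])) G) :=
    associated_of_relation hp2' hK ι hκ hγ hJ hC₁ g₀ hrel
  have e : PowerSeries.map (PowerSeries.constantCoeff (R := 𝓞_ℂ_[p]))
      (PowerSeries.map (PowerSeries.map J) g) =
      PowerSeries.map J (g.map (PowerSeries.constantCoeff (R := ℤ_[p]))) := by
    ext n
    simp only [PowerSeries.coeff_map, ← PowerSeries.coeff_zero_eq_constantCoeff_apply]
  have hassoc' : Associated (PowerSeries.map J (g.map (PowerSeries.constantCoeff (R := ℤ_[p]))))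
      (PowerSeries.map (PowerSeries.constantCoeff (R := 𝓞_ℂ_[p])) G) := by
    rw [← e]
    exact hassoc.map (PowerSeries.map (PowerSeries.constantCoeff (R := 𝓞_ℂ_[p])))
  have hc₀u : IsUnit (PowerSeries.C c₀ : PowerSeries 𝓞_ℂ_[p]) :=
    (isUnit_padicComplexInt_iff.mpr hc₀n).map PowerSeries.C
  have hassocQ : Associated (PowerSeries.map J (g.map (PowerSeries.constantCoeff (R := ℤ_[p])))) Q := by
    refine (hassoc'.trans hassocGc.symm).trans ?_
    rw [hQdef]
    exact (associated_unit_mul_left _ _ hc₀u).symm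
  -- `g(S=0) ≠ 0`: otherwise `Q = 0` and then `L♭ = 0` (frames vanish together)
  have hg : g.map (PowerSeries.constantCoeff (R := ℤ_[p])) ≠ 0 := by
    intro h0
    have hQ0 : Q = 0 := by
      obtain ⟨u, hu⟩ := hassocQ
      rw [← hu, h0, map_zero, zero_mul]
    have hL0 := katzFlat_eq_zero_of_eq_zero hp2' hK hκ hγ hfin hΩ hΩp' hQ hLflat hQ0
    obtain ⟨i, hi⟩ := hLunit
    rw [hL0, map_zero, ZeroMemClass.coe_zero, norm_zero] at hi
    exact zero_ne_one hi
  -- the power-map identity `Q(Φ)·L♭^p = Q^p·L♭(Φ)` and §1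
  have hid := katzFlat_powerMap_identity hp2' hK hκ hγ hfin hΩK'' hΩp'' hLflat hQ
  exact map_residue_ne_zero_of_powMap_identity_of_associated hLunit hJ hg hassocQ hid

end Summit.BirchSwinnertonDyer.BirchSwinnertonDyer.Theorems.KatzLineReverseMuTransfer

end
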